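import Mathlib
import Summits.Ventures.PercRepro2.SwOutCrossJunctionSwG3

/-!
# Any number of connected dropped components at one junction (blind cell PercRepro2, night-4
g25, 2026-08-28; proofs/NIGHT4-G25.md §4″)

A list of connected components (`CompG`: a finite non-empty vertex type with a connected cross
graph) is glued into ONE dropped structure on the nested disjoint union `sumX c l` with the cross
graph `sumG c l` (`(… (c_n ⊕g c_{n-1}) …) ⊕g c`); the glued fibre `fibKEESumN` carries the `KE`
fields (bundled with their proofs in `KEFibre`, so that the recursion type-checks) and the
inequality by induction on the list (`ineq_fibKEESumN`, from `ineq_ofBit` and `ineq_fibKEESum`).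
Hence `IneqAll (sumG c l) V` (`ineqAll_sumN`) and **`sw_of_crossJunctionN`**: row (SW) on every
graph with a junction whose dropped vertices form ANY finite number of connected cross-edge
components — Theorem A_cross for several components in one statement.
-/

namespace Summit.Ventures.PercRepro2

namespace CrossArm

open Hull LocRows

universe u uV

/-- A connected component: a finite non-empty vertex type with a connected cross graph. -/
structure CompG : Type (u + 1) where
  /-- the dropped vertices of the component -/
  X : Type u
  /-- its cross-edge graph -/
  G : SimpleGraph X
  /-- finiteness -/
  [fX : Fintype X]
  /-- decidable equality -/
  [dX : DecidableEq X]
  /-- decidable adjacency -/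
  [dG : DecidableRel G.Adj]
  /-- non-emptiness -/
  [nX : Nonempty X]
  /-- connectivity -/
  hG : G.Connected

attribute [instance] CompG.fX CompG.dX CompG.dG CompG.nX

/-- The nested disjoint union of the vertex types of a component and a list of components. -/
def sumX : CompG.{u} → List CompG.{u} → Type u
  | c, [] => c.X
  | c, d :: l => sumX d l ⊕ c.X

/-- The nested disjoint union of the cross graphs. -/
def sumG : ∀ (c : CompG.{u}) (l : List CompG.{u}), SimpleGraph (sumX c l)
  | c, [] => c.G
  | c, d :: l => sumG d l ⊕g c.G

/-- `sumX` is finite. -/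
instance instFintypeSumX : ∀ (c : CompG.{u}) (l : List CompG.{u}), Fintype (sumX c l)
  | c, [] => c.fX
  | c, d :: l => @instFintypeSum _ _ (instFintypeSumX d l) c.fX

/-- `sumX` has decidable equality. -/
instance instDecidableEqSumX : ∀ (c : CompG.{u}) (l : List CompG.{u}), DecidableEq (sumX c l)
  | c, [] => c.dX
  | c, d :: l => @instDecidableEqSum _ _ (instDecidableEqSumX d l) c.dX

/-- `sumX` is non-empty. -/
instance instNonemptySumX : ∀ (c : CompG.{u}) (l : List CompG.{u}), Nonempty (sumX c l)
  | c, [] => c.nX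
  | c, _ :: _ => ⟨Sum.inr (Classical.choice c.nX)⟩

/-- A fibre with the `KE` fields, the proofs bundled. -/
def KEFibre (X : Type u) (G : SimpleGraph X) :=
  {F : FibreIter (FibKE X G) (AtomKEE X G) (LabelKE X) //
    F.flip = FibKE.flip ∧ F.leakR = leakKE G ∧ F.label = labelKE G ∧ F.BetterL = BetterKE ∧
      F.red = redKEE G}

open Classical in
/-- The glued fibre of a list of components, with its `KE` fields. -/
noncomputable def fibKEESumN : ∀ (c : CompG.{u}) (l : List CompG.{u}), KEFibre (sumX c l) (sumG c l)
  | c, [] => ⟨FibreIter.ofBit (fibKEEBit c.G c.hG), rfl, rfl, rfl, rfl, rfl⟩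
  | c, d :: l =>
    ⟨fibKEESum c.G (fibKEESumN d l).1 (fibKEESumN d l).2.1 (fibKEESumN d l).2.2.1
        (fibKEESumN d l).2.2.2.1 (fibKEESumN d l).2.2.2.2.1 (fibKEESumN d l).2.2.2.2.2,
      rfl, rfl, rfl, rfl, rfl⟩

section Ineq

variable {ι : Type*} [Fintype ι] [DecidableEq ι] [Nonempty ι]

omit [Nonempty ι] in
/-- The inequality of a fibre does not depend on its finiteness instance (a subsingleton). -/
lemma Ineq.congr_inst {W A L : Type*} (F : FibreIter W A L) (i₁ : Fintype W) [i₂ : Fintype W]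
    (h : letI := i₁; Ineq F (ι := ι)) : Ineq F (ι := ι) := by
  obtain rfl : i₁ = i₂ := Subsingleton.elim _ _
  exact h

open Classical in
/-- **The glued fibre of a list of components has the inequality**, by induction on the list. -/
theorem ineq_fibKEESumN : ∀ (c : CompG.{u}) (l : List CompG.{u}), Ineq (fibKEESumN c l).1 (ι := ι)
  | c, [] => Ineq.congr_inst _ _ (ineq_ofBit (fibKEEBit c.G c.hG))
  | c, d :: l =>
    Ineq.congr_inst _ _ (ineq_fibKEESum c.G c.hG (fibKEESumN d l).1 (fibKEESumN d l).2.1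
      (fibKEESumN d l).2.2.1 (fibKEESumN d l).2.2.2.1 (fibKEESumN d l).2.2.2.2.1
      (fibKEESumN d l).2.2.2.2.2 (Ineq.congr_inst _ _ (ineq_fibKEESumN d l)))

/-- The record of a `KEFibre` is the `KE` record. -/
lemma KEFibre.toMin_eq {X : Type u} {G : SimpleGraph X} (F : KEFibre X G) :
    F.1.toMin = fibKEEMin G := by
  obtain ⟨F, h1, h2, h3, h4, h5⟩ := F
  simp only [FibreIter.toMin, fibKEEMin, h1, h2, h3, h4, h5]

open Classical in
/-- **The record of the nested sum of a list of components has the inequality.** -/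
theorem ineqM_sumN (c : CompG.{u}) (l : List CompG.{u}) : IneqM (fibKEEMin (sumG c l)) (ι := ι) := by
  have h := ineqM_of_ineq _ (ineq_fibKEESumN (ι := ι) c l)
  rwa [KEFibre.toMin_eq] at h

end Ineq

section Junction

variable {V : Type uV} {E : Type*} [Fintype E] [DecidableEq E]

open scoped Classical

variable (c : CompG.{u}) (l : List CompG.{u}) {ends : E → Sym2 V} {U : Set V} {l₀ h o u : V}
  {p : sumX c l → V}

/-- **The record of any list of connected components has the inequality over every u-arm
type.** -/
theorem ineqAll_sumN : IneqAll (sumG c l) V := by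
  intro S _ _ _ _ _
  exact IneqM.congr_inst _ _ (ineqM_sumN c l (ι := {P // P ∈ S}))

/-- **THEOREM A_cross FOR ANY NUMBER OF CONNECTED DROPPED COMPONENTS AT ONE JUNCTION**: the
rigid inequality on every class, for every outside colouring. -/
theorem CrossJunction.rigidOK_of_crossJunctionN (hj : CrossJunction ends U h u p (sumG c l) o)
    (hl : l₀ ∉ U) (ξ : Config E) : RigidOK ends l₀ h o U ξ :=
  hj.rigidOK_of_crossJunction' hl (ineqAll_sumN c l)

/-- **Row (SW) on every graph with a junction whose dropped vertices form any finite number of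
connected cross-edge components.** -/
theorem sw_of_crossJunctionN (hlh : l₀ ≠ h) (hj : CrossJunction ends ({l₀}ᶜ) h u p (sumG c l) o) :
    Sw ends l₀ h o :=
  sw_of_crossJunction' hlh hj (ineqAll_sumN c l)

end Junction

end CrossArm

end Summit.Ventures.PercRepro2
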